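import Summits.BirchSwinnertonDyer.Rank1Residual.X11b.AnticyclotomicDualPair
import Literature.NumberTheory.EllipticCurves.IwasawaSelmerIsTorsionProofs
import Literature.NumberTheory.EllipticCurves.LeadingTermPPartProofs
import Mathlib.GroupTheory.PGroup
import HarnessLib

/-!
# X11b, route R1 — "`ord_p f_ac^Σ(0) = n`" IS a `Γ`-EULER CHARACTERISTIC:
# `XAc.HasCharValuationAt … n ↔ #Sel^Γ = p^n · #Sel_Γ` (no `Λ`-structure on the right)

HONEST FRAMING (cell `b2b-bsdres`, run/shared/lean/b2b/bsd-rank1-residual/, verbatim in every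
file): the goal of the cell is to DELETE the COMBINATION-SHAPED residual classes of the
Birch–Swinnerton-Dyer formula for ALL analytic-rank `≤ 1` elliptic curves over `ℚ` — "full BSD
formula for every rank `≤ 1` curve in class `C`" assembled STRICTLY from published theorems — so
that the rank-`≤ 1` remainder becomes exactly the CONSTRUCTION-SHAPED classes, which are TYPED
(missing-input `Prop`s), NOT attempted. This is not "finishing BSD". Sub-cell
`b2b-bsdres-multr1-p1` (X11b, route R1 = Castella 2018 Thm. A re-proved along the author's
erratum); a RESEARCH ROUTE; no claim beyond the stated class; X11b stays CONSTRUCTION-SHAPED;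
nothing here changes a label; no named fact is minted (theorems only; no `sorry`).

## Content

The algebraic side of route R1's ONE open input (`IMCWaldspurgerOnTreeAt`: "`ord_p f_ac(0) =
2·(ord_p log_ω P − 1)`", `AnticyclotomicLogLinks.lean`) and of Cas18 Thm. 2.3 (`ControlOnTreeAt`)
is the predicate `XAc.HasCharValuationAt W p κ 𝔭 S γ n` of `AnticyclotomicSelmerDual.lean`:
"`X_ac^Σ(E[p^∞])` is `Λ`-torsion, `Ch_Λ(X_ac^Σ) = (f)`, `f(0) ≠ 0`, `ord_p f(0) = n`". This file proves
that, for finite `Σ`, this predicate is EQUIVALENT to a statement about two finite groups attached to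
Castella's Selmer group `Sel = Sel_𝔭^Σ(K_∞, E[p^∞])` and the topological generator `γ`, with no
reference to the `Λ`-module structure, characteristic ideals or power series:

  **`XAc.hasCharValuationAt_iff_card`**:
  `HasCharValuationAt W p κ 𝔭 S γ n ↔ Sel^γ is finite ∧ #Sel^γ = p^n · #Sel_γ`,

where `Sel^γ = {s | conj_γ s = s} = H⁰(Γ, Sel)` (`IwasawaDual.endInvariants (conj_γ − 1)`) and
`Sel_γ = Sel/(conj_γ − 1)Sel ≅ H¹(Γ, Sel)` (`IwasawaDual.EndCoinvariants`), i.e.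
**`p^{ord_p f_ac^Σ(0)} = χ(Γ, Sel_𝔭^Σ(K_∞, E[p^∞])) = #H⁰(Γ, Sel)/#H¹(Γ, Sel)`** — Greenberg's Lemma 4.2
(LNM 1716, §4 p. 102: "Assume that `S^Γ` is finite. Then `S_Γ` is finite, `f(0) ≠ 0`, and
`f(0) ∼ |S^Γ|/|S_Γ|`") together with ITS CONVERSE (`f(0) ≠ 0 ⇒ X/TX` finite, i.e. `S^Γ` finite) and
Greenberg's torsion criterion (`S^Γ` finite ⇒ `X` finitely generated and `Λ`-torsion,
`IwasawaDual.IsDualPair.module_finite_and_isTorsion_of_finite_ker`), run on the dual pair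
`(X_ac^Σ, Sel_𝔭^Σ)` (`XAc.isDualPair`), with `X_ac^Σ` finitely generated where needed (for finite `Σ`
this is `XAc.module_finite` of `AnticyclotomicModuleFinite.lean`; the corollaries with that
hypothesis discharged are in `AnticyclotomicEulerCharLinks.lean`).

* the converse half "`f(0) ≠ 0 ⇒ X/TX` finite" is the tree's
  `IwasawaAlgebra.finite_coinvariants_of_constantCoeff_ne_zero` (`LeadingTermPPartProofs`).
* `exists_natCard_eq_prime_pow_of_forall` (generic): a finite abelian group killed elementwise by
  powers of `p` has order a power of `p` (Mathlib `IsPGroup.iff_card`); `selmerAc_exists_pow_smul_eq_zero`: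
  `Sel_𝔭^Σ(K_∞, E[p^∞])` is `p`-primary; hence `#Sel^γ`, `#Sel_γ` are powers of `p` when finite.
* **`XAc.card_of_hasCharValuationAt`** (→, needs `X_ac^Σ` finitely generated — for finite `Σ` this is
  `XAc.module_finite` of `AnticyclotomicModuleFinite.lean`),
  **`XAc.hasCharValuationAt_of_card`** (←, no finiteness hypothesis on `Σ`: `Sel^γ` finite already forces
  `X_ac^Σ` finitely generated and torsion), **`XAc.hasCharValuationAt_iff_card`**.
* `conjSelmerAc_eq_of_isTopGenerator`: two topological generators of the SAME `κ` (`κ γᵢ = 1`) act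
  identically on `Sel` (they differ by an element of `ker κ = Gal(K̄/K_∞)`, `conjH1_of_mem_holds`);
  hence **`XAc.hasCharValuationAt_iff_of_isTopGenerator`**: the predicate does not depend on the choice
  of `γ`.

Consequence for the route (bookkeeping, nothing booked): the open input "`ord_p f_ac(0) =
2(ord_p log_ω P − 1)`" on `R1Population` is equivalently the Euler-characteristic identity
`#Sel_𝔭(K_∞, E[p^∞])^Γ = p^{2(ord_p log_ω P − 1)} · #Sel_𝔭(K_∞, E[p^∞])_Γ` — the form in which
Jetchev–Skinner–Wan prove the anticyclotomic control theorem (JSW17 §3.3) — see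
`AnticyclotomicEulerCharLinks.lean`.

References: [GreenbergLNM1716] §4 Lemma 4.2 (p. 102), §1 p. 60; [Castella2018] Thm. 2.3, §5 (5.1)
(arXiv:1704.06608 pp. 5, 12); [CoatesSchneiderSujatha2003] §3 (30)–(31);
[JetchevSkinnerWan2017] §3.3.
-/

noncomputable section

universe u

/-! ## Generic: finite `p`-primary abelian groups have order a power of `p` -/

namespace Summit.BirchSwinnertonDyer.Rank1Residual.X11b.AcSelmer

open scoped Classical

open NumberField IsDedekindDomain Field
open Literature.NumberTheory.EllipticCurves Literature.NumberTheory.EllipticCurves.GreenbergSelmer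
open Literature.NumberTheory.GaloisRepresentations

/-- A finite abelian group every element of which is killed by a power of `p` has order a power of
`p` (it is a `p`-group: Mathlib `IsPGroup.iff_card` on `Multiplicative A`). [folklore] -/
theorem exists_natCard_eq_prime_pow_of_forall {p : ℕ} [Fact p.Prime] {A : Type*} [AddCommGroup A]
    [Finite A] (h : ∀ a : A, ∃ k : ℕ, p ^ k • a = 0) : ∃ n : ℕ, Nat.card A = p ^ n := by
  have hP : IsPGroup p (Multiplicative A) := fun g ↦ by
    obtain ⟨k, hk⟩ := h (Multiplicative.toAdd g)
    exact ⟨k, Multiplicative.toAdd.injective (by rw [toAdd_pow, toAdd_one]; exact hk)⟩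
  obtain ⟨n, hn⟩ := IsPGroup.iff_card.mp hP
  exact ⟨n, hn⟩

variable {K : Type u} [Field K] [NumberField K] (W : WeierstrassCurve K) (p : ℕ) [Fact p.Prime]
  (κ : ZpExtension K p) (𝔭 : HeightOneSpectrum (𝓞 K)) (S : Set (HeightOneSpectrum (𝓞 K)))

/-- **`Sel_𝔭^Σ(K_∞, E[p^∞])` is `p`-primary**: every class is killed by a power of `p` (it lives in
`H¹(K_∞, E[p^∞])`; compactness of `Gal(K̄/K_∞)`, `exists_pow_smul_subgroupH1_ker_eq_zero`).
[cite: GreenbergLNM1716, §1 (after Conj. 1.3), "a torsion `ℤ_p`-module"] -/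
theorem selmerAc_exists_pow_smul_eq_zero (s : selmerAc W p κ 𝔭 S) : ∃ k : ℕ, p ^ k • s = 0 := by
  obtain ⟨k, hk⟩ := W.exists_pow_smul_subgroupH1_ker_eq_zero κ (s : W.subgroupH1 p κ.kerSubgroup)
  exact ⟨k, Subtype.ext (by rw [AddSubgroupClass.coe_nsmul]; exact hk)⟩

variable (γ : absoluteGaloisGroup K)

/-- `#Sel^γ` is a power of `p` when `Sel^γ = {s ∈ Sel_𝔭^Σ(K_∞, E[p^∞]) | conj_γ s = s}` is finite. [folklore] -/
theorem exists_natCard_endInvariants_eq_pow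
    [Finite (IwasawaDual.endInvariants (conjSelmerAc W p κ 𝔭 S γ - 1))] :
    ∃ a : ℕ, Nat.card (IwasawaDual.endInvariants (conjSelmerAc W p κ 𝔭 S γ - 1)) = p ^ a :=
  exists_natCard_eq_prime_pow_of_forall fun s ↦ by
    obtain ⟨k, hk⟩ := selmerAc_exists_pow_smul_eq_zero W p κ 𝔭 S (s : selmerAc W p κ 𝔭 S)
    exact ⟨k, Subtype.ext (by rw [AddSubgroupClass.coe_nsmul, hk]; rfl)⟩

/-- `#Sel_γ` is a power of `p` when `Sel_γ = Sel/(conj_γ − 1)Sel` is finite. [folklore] -/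
theorem exists_natCard_endCoinvariants_eq_pow
    [Finite (IwasawaDual.EndCoinvariants (conjSelmerAc W p κ 𝔭 S γ - 1))] :
    ∃ b : ℕ, Nat.card (IwasawaDual.EndCoinvariants (conjSelmerAc W p κ 𝔭 S γ - 1)) = p ^ b :=
  exists_natCard_eq_prime_pow_of_forall fun q ↦ by
    induction q using QuotientAddGroup.induction_on with
    | H s =>
      obtain ⟨k, hk⟩ := selmerAc_exists_pow_smul_eq_zero W p κ 𝔭 S s
      exact ⟨k, by rw [← QuotientAddGroup.mk_nsmul, hk, QuotientAddGroup.mk_zero]⟩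

/-! ## `ord_p f_ac^Σ(0) = n` as an Euler characteristic -/

namespace XAc

variable [hγ : Fact (κ.IsTopGenerator γ)]

/-- Valuation bookkeeping: from `c₀ · p^b = u · p^a` in `ℤ_p` with `c₀ ≠ 0`, `u` a unit:
`ord_p c₀ + b = a`. [folklore] -/
theorem valuation_add_eq_of_mul_pow_eq {c₀ : ℤ_[p]} (hc₀ : c₀ ≠ 0) (u : ℤ_[p]ˣ) {a b : ℕ}
    (h : c₀ * ((p ^ b : ℕ) : ℤ_[p]) = u * ((p ^ a : ℕ) : ℤ_[p])) : c₀.valuation + b = a := by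
  have hp0 : (p : ℤ_[p]) ≠ 0 := NeZero.ne _
  rw [Nat.cast_pow, Nat.cast_pow] at h
  have hv := congrArg PadicInt.valuation h
  rwa [PadicInt.valuation_mul hc₀ (pow_ne_zero _ hp0), PadicInt.valuation_mul u.ne_zero
    (pow_ne_zero _ hp0), PadicInt.valuation_pow, PadicInt.valuation_pow, PadicInt.valuation_p,
    mul_one, mul_one, padicInt_valuation_eq_zero_of_isUnit u.isUnit, zero_add] at hv

/-- **(→) "`ord_p f_ac^Σ(0) = n`" ⇒ `Sel^γ` finite and `#Sel^γ = p^n · #Sel_γ`** (`X_ac^Σ` finitely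
generated — for finite `Σ` by `XAc.module_finite`): `f(0) ≠ 0` forces `X_ac^Σ/T` finite
(tree `IwasawaAlgebra.finite_coinvariants_of_constantCoeff_ne_zero`), i.e. `Sel^γ` finite (duality,
`finite_coinvariants_iff`); then Greenberg's Lemma 4.2 (`XAc.eulerChar`: `f(0)·#Sel_γ = u·#Sel^γ`) and
`#Sel^γ = p^a`, `#Sel_γ = p^b` give `a = n + b`.
[cite: GreenbergLNM1716, §4 Lemma 4.2 (p. 102)] [cite: Castella2018, Thm. 2.3 (arXiv:1704.06608 p. 5), "`#ℤ_p/f_ac^Σ(0)`"] -/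
theorem card_of_hasCharValuationAt [Module.Finite (IwasawaAlgebra p) (XAc W p κ 𝔭 S γ)] {n : ℕ}
    (h : HasCharValuationAt W p κ 𝔭 S γ n) :
    ∃ _ : Finite (IwasawaDual.endInvariants (conjSelmerAc W p κ 𝔭 S γ - 1)),
      Nat.card (IwasawaDual.endInvariants (conjSelmerAc W p κ 𝔭 S γ - 1)) =
        p ^ n * Nat.card (IwasawaDual.EndCoinvariants (conjSelmerAc W p κ 𝔭 S γ - 1)) := by
  obtain ⟨hT, f, hf, hf0, hval⟩ := h
  have hfmem : f ∈ Module.charIdeal (IwasawaAlgebra p) (XAc W p κ 𝔭 S γ) := by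
    rw [show Module.charIdeal (IwasawaAlgebra p) (XAc W p κ 𝔭 S γ) = Ideal.span {f} from hf]
    exact Ideal.mem_span_singleton_self f
  have hcoinv : Finite (IwasawaAlgebra.coinvariants p (XAc W p κ 𝔭 S γ)) :=
    IwasawaAlgebra.finite_coinvariants_of_constantCoeff_ne_zero p (XAc W p κ 𝔭 S γ) hT f hfmem hf0
  haveI hinv : Finite (IwasawaDual.endInvariants (conjSelmerAc W p κ 𝔭 S γ - 1)) :=
    (finite_coinvariants_iff W p κ 𝔭 S γ).mp hcoinv
  refine ⟨hinv, ?_⟩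
  obtain ⟨hcofin, -, -, u, hu⟩ := eulerChar W p κ 𝔭 S γ hT f hf hinv
  haveI := hcofin
  obtain ⟨a, ha⟩ := exists_natCard_endInvariants_eq_pow W p κ 𝔭 S γ
  obtain ⟨b, hb⟩ := exists_natCard_endCoinvariants_eq_pow W p κ 𝔭 S γ
  rw [ha, hb] at hu ⊢
  have hab := valuation_add_eq_of_mul_pow_eq p hf0 u hu
  rw [hval] at hab
  rw [← pow_add, hab]

/-- **(←) `Sel^γ` finite and `#Sel^γ = p^n · #Sel_γ` ⇒ "`ord_p f_ac^Σ(0) = n`"** (any `Σ`): `Sel^γ` finite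
makes `X_ac^Σ` finitely generated AND `Λ`-torsion (Greenberg's criterion for the dual pair,
`IwasawaDual.IsDualPair.module_finite_and_isTorsion_of_finite_ker`); `Ch_Λ(X_ac^Σ)` is principal
(`charIdeal_isPrincipal_holds`, `Λ` factorial); Lemma 4.2 (`XAc.eulerChar`) gives `f(0) ≠ 0` and
`f(0)·#Sel_γ = u·#Sel^γ`, whence `ord_p f(0) = n`.
[cite: GreenbergLNM1716, §4 Lemma 4.2 (p. 102) and §1 p. 60] [cite: Castella2018, Thm. 2.3 (arXiv:1704.06608 p. 5)] -/
theorem hasCharValuationAt_of_card {n : ℕ}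
    (hinv : Finite (IwasawaDual.endInvariants (conjSelmerAc W p κ 𝔭 S γ - 1)))
    (hcard : Nat.card (IwasawaDual.endInvariants (conjSelmerAc W p κ 𝔭 S γ - 1)) =
      p ^ n * Nat.card (IwasawaDual.EndCoinvariants (conjSelmerAc W p κ 𝔭 S γ - 1))) :
    HasCharValuationAt W p κ 𝔭 S γ n := by
  have hp := (Fact.out : p.Prime)
  have hker : Set.Finite {s : selmerAc W p κ 𝔭 S | (conjSelmerAc W p κ 𝔭 S γ - 1) s = 0} := by
    have e : {s : selmerAc W p κ 𝔭 S | (conjSelmerAc W p κ 𝔭 S γ - 1) s = 0} =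
        (IwasawaDual.endInvariants (conjSelmerAc W p κ 𝔭 S γ - 1) : Set (selmerAc W p κ 𝔭 S)) := by
      ext s
      rw [Set.mem_setOf_eq, SetLike.mem_coe, IwasawaDual.mem_endInvariants_iff]
    rw [e]
    exact Set.toFinite _
  obtain ⟨hfg, hT⟩ :=
    (isDualPair W p κ 𝔭 S γ).module_finite_and_isTorsion_of_finite_ker hker
  haveI : Module.Finite (IwasawaAlgebra p) (XAc W p κ 𝔭 S γ) := hfg
  obtain ⟨f, hf⟩ :=
    (Literature.NumberTheory.EllipticCurves.charIdeal_isPrincipal_holds p (XAc W p κ 𝔭 S γ)).principal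
  have hf' : XAc.charIdeal W p κ 𝔭 S γ = Ideal.span {f} := hf
  haveI := hinv
  obtain ⟨hcofin, -, hf0, u, hu⟩ := eulerChar W p κ 𝔭 S γ hT f hf' hinv
  haveI := hcofin
  refine ⟨hT, f, hf', hf0, ?_⟩
  obtain ⟨a, ha⟩ := exists_natCard_endInvariants_eq_pow W p κ 𝔭 S γ
  obtain ⟨b, hb⟩ := exists_natCard_endCoinvariants_eq_pow W p κ 𝔭 S γ
  rw [ha, hb] at hu hcard
  have hab := valuation_add_eq_of_mul_pow_eq p hf0 u hu
  rw [← pow_add] at hcard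
  have hnb : a = n + b := Nat.pow_right_injective hp.two_le hcard
  omega

/-- **"`ord_p f_ac^Σ(0) = n`" IS A `Γ`-EULER CHARACTERISTIC** (`X_ac^Σ` finitely generated, e.g. `Σ`
finite, `XAc.module_finite`): for the constructed
`Λ`-module `X_ac^Σ(E[p^∞])`,
`HasCharValuationAt W p κ 𝔭 S γ n` ("`X_ac^Σ` is `Λ`-torsion, `Ch_Λ(X_ac^Σ) = (f)`, `f(0) ≠ 0`,
`ord_p f(0) = n`") holds IF AND ONLY IF `Sel^γ = H⁰(Γ, Sel_𝔭^Σ(K_∞, E[p^∞]))` is finite and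
`#H⁰(Γ, Sel) = p^n · #H¹(Γ, Sel)` (`H¹(Γ, Sel) ≅ Sel_γ = Sel/(γ − 1)Sel`). The right-hand side mentions no
`Λ`-module structure, characteristic ideal or power series. Greenberg's Lemma 4.2 with its converse
and his torsion criterion, on the dual pair `(X_ac^Σ, Sel_𝔭^Σ)`.
[cite: GreenbergLNM1716, §4 Lemma 4.2 (p. 102)] [cite: CoatesSchneiderSujatha2003, §3 (30)–(31)] [cite: Castella2018, Thm. 2.3 and §5 (5.1) (arXiv:1704.06608 pp. 5, 12)] -/
theorem hasCharValuationAt_iff_card [Module.Finite (IwasawaAlgebra p) (XAc W p κ 𝔭 S γ)] (n : ℕ) :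
    HasCharValuationAt W p κ 𝔭 S γ n ↔
      ∃ _ : Finite (IwasawaDual.endInvariants (conjSelmerAc W p κ 𝔭 S γ - 1)),
        Nat.card (IwasawaDual.endInvariants (conjSelmerAc W p κ 𝔭 S γ - 1)) =
          p ^ n * Nat.card (IwasawaDual.EndCoinvariants (conjSelmerAc W p κ 𝔭 S γ - 1)) :=
  ⟨card_of_hasCharValuationAt W p κ 𝔭 S γ, fun ⟨hinv, hcard⟩ ↦
    hasCharValuationAt_of_card W p κ 𝔭 S γ hinv hcard⟩

/-- **`X_ac^Σ(E[p^∞])` is `Λ`-torsion (and "`ord_p f_ac^Σ(0)`" is defined) as soon as `Sel^γ` is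
finite** — Greenberg's criterion on the dual pair: the torsion clause of Cas18 Thm. 2.3 / erratum
Thm. 1.1 for the constructed module REDUCES to the finiteness of
`H⁰(Γ, Sel_𝔭^Σ(K_∞, E[p^∞]))`. [cite: GreenbergLNM1716, §1 p. 60 and §4 Lemma 4.2] -/
theorem exists_hasCharValuationAt_of_finite
    (hinv : Finite (IwasawaDual.endInvariants (conjSelmerAc W p κ 𝔭 S γ - 1))) :
    ∃ n : ℕ, HasCharValuationAt W p κ 𝔭 S γ n := by
  have hp := (Fact.out : p.Prime)
  haveI := hinv
  -- `Sel_γ` is finite too (Lemma 4.2 (i) needs torsion + f.g., which the criterion provides)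
  have hker : Set.Finite {s : selmerAc W p κ 𝔭 S | (conjSelmerAc W p κ 𝔭 S γ - 1) s = 0} := by
    have e : {s : selmerAc W p κ 𝔭 S | (conjSelmerAc W p κ 𝔭 S γ - 1) s = 0} =
        (IwasawaDual.endInvariants (conjSelmerAc W p κ 𝔭 S γ - 1) : Set (selmerAc W p κ 𝔭 S)) := by
      ext s
      rw [Set.mem_setOf_eq, SetLike.mem_coe, IwasawaDual.mem_endInvariants_iff]
    rw [e]
    exact Set.toFinite _
  obtain ⟨hfg, hT⟩ :=
    (isDualPair W p κ 𝔭 S γ).module_finite_and_isTorsion_of_finite_ker hker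
  haveI : Module.Finite (IwasawaAlgebra p) (XAc W p κ 𝔭 S γ) := hfg
  obtain ⟨f, hf⟩ :=
    (Literature.NumberTheory.EllipticCurves.charIdeal_isPrincipal_holds p (XAc W p κ 𝔭 S γ)).principal
  have hf' : XAc.charIdeal W p κ 𝔭 S γ = Ideal.span {f} := hf
  obtain ⟨-, -, hf0, -⟩ := eulerChar W p κ 𝔭 S γ hT f hf' hinv
  exact ⟨_, hT, f, hf', hf0, rfl⟩

end XAc

/-! ## Independence of the topological generator -/

/-- **Two topological generators of the same `κ` act identically on `Sel_𝔭^Σ(K_∞, E[p^∞])`**: with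
the tree's normalisation `κ γᵢ = 1`, `γ₁⁻¹ γ₂ ∈ ker κ = Gal(K̄/K_∞)` acts trivially on `H¹(K_∞, E[p^∞])`
(`conjH1_of_mem_holds`, Serre *Local Fields* VII §5 Prop. 3), so `conj_{γ₂} = conj_{γ₁} ∘ conj_{γ₁⁻¹γ₂}
= conj_{γ₁}`. [cite: SerreLocalFields1979, VII.§5 Prop. 3] -/
theorem conjSelmerAc_eq_of_isTopGenerator {γ₁ γ₂ : absoluteGaloisGroup K}
    (h₁ : κ.IsTopGenerator γ₁) (h₂ : κ.IsTopGenerator γ₂) :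
    conjSelmerAc W p κ 𝔭 S γ₁ = conjSelmerAc W p κ 𝔭 S γ₂ := by
  have hmem : γ₁⁻¹ * γ₂ ∈ κ.kerSubgroup := by
    rw [ZpExtension.mem_kerSubgroup, map_mul, map_inv, h₁, h₂, inv_mul_cancel]
  have hH1 : W.conjH1 p κ.kerSubgroup γ₂ = W.conjH1 p κ.kerSubgroup γ₁ := by
    rw [show γ₂ = γ₁ * (γ₁⁻¹ * γ₂) by group, W.conjH1_mul_holds p κ.kerSubgroup,
      W.conjH1_of_mem_holds p κ.kerSubgroup hmem, AddMonoidHom.comp_id]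
  refine DFunLike.ext _ _ fun s ↦ Subtype.ext ?_
  simp only [coe_conjSelmerAc_apply, hH1]

/-- **`XAc.HasCharValuationAt` does not depend on the topological generator** (`X_ac^Σ` finitely
generated for both, e.g. `Σ` finite): for two
topological generators `γ₁, γ₂` of `κ`, `HasCharValuationAt … γ₁ n ↔ HasCharValuationAt … γ₂ n` — by
`hasCharValuationAt_iff_card`, both sides are the same statement about `Sel^{γ} ` and `Sel_{γ}`, and
`conj_{γ₁} = conj_{γ₂}` on `Sel` (`conjSelmerAc_eq_of_isTopGenerator`). (The `Λ`-module structures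
`instModuleXAc … γ₁`, `… γ₂` on the common underlying group `Hom(Sel, ℚ/ℤ)` are not compared
directly.) [cite: Castella2018, §2.2 (arXiv:1704.06608 p. 5), "a fixed topological generator"] [cite: Washington1997, §13.2 (Thm. 7.1 ff.)] -/
theorem XAc.hasCharValuationAt_iff_of_isTopGenerator
    (γ₁ γ₂ : absoluteGaloisGroup K) [h₁ : Fact (κ.IsTopGenerator γ₁)]
    [h₂ : Fact (κ.IsTopGenerator γ₂)] [Module.Finite (IwasawaAlgebra p) (XAc W p κ 𝔭 S γ₁)]
    [Module.Finite (IwasawaAlgebra p) (XAc W p κ 𝔭 S γ₂)] (n : ℕ) :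
    XAc.HasCharValuationAt W p κ 𝔭 S γ₁ n ↔ XAc.HasCharValuationAt W p κ 𝔭 S γ₂ n := by
  rw [XAc.hasCharValuationAt_iff_card W p κ 𝔭 S γ₁ n,
    XAc.hasCharValuationAt_iff_card W p κ 𝔭 S γ₂ n,
    conjSelmerAc_eq_of_isTopGenerator W p κ 𝔭 S h₁.out h₂.out]

end Summit.BirchSwinnertonDyer.Rank1Residual.X11b.AcSelmer

end
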